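import Literature.MathematicalPhysics.QuantumLattice.HubbardEffectiveActionCT
import Literature.MathematicalPhysics.QuantumLattice.GrassmannGaussianQuadraticNormalisation
import HarnessLib

/-!
# The counterterm frame as a change of Gaussian covariance: `C^K − C^0 = C^K S_K C^0`

Topic `Literature/MathematicalPhysics/QuantumLattice`; companion of `HubbardEffectiveActionCT.lean` (the seeded Hubbard torus in
a counterterm frame `K`, Feldman–Salmhofer–Trubowitz 1996 §1: `E = e + K`, "the counterterm treated as an extra interaction
vertex") and of `GrassmannGaussianQuadraticInsertion.lean` / `GrassmannGaussianQuadraticNormalisation.lean` (a quadratic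
insertion renormalises the Laplacian-form Gaussian covariance).

At finite `(L, M, β)` the frame is EXACT bookkeeping: the free covariance `C^K` of the renormalised band `e_K = ξ − K` and the
bare covariance `C^0 = C` are related by the resolvent (Dyson) identity

  `C^K − C^0 = C^K S_K C^0`,  `S_K = N_K − N_Kᵀ`,  `−𝒩_K = Σ_{X,Y} N_K(X,Y) ψ(X)ψ(Y)`

(`hubbardCovarianceCT_sub_eq_mul_counterMatrix_mul`; blockwise it is `G_K − G_0 = K(p) G_K τ₃ G_0 = K(p) G_0 τ₃ G_K` for the
Nambu propagators, `nambuPropagatorCT_sub_eq_mul_tau3_mul(')`, lifted through the antisymmetrised Nambu tables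
`nambuAnti_resolvent` and the spin/reflection bookkeeping `mul_counterMatrix_mul_apply`, `counter_sum_toNambu`), whence
`(1 + C^K S_K)(1 − C^0 S_K) = 1` and `(1 − C^0 S_K) C^K = C^0` (`counterResolvent_mul`, `counterResolvent_mul'`,
`counterResolvent_mul_hubbardCovarianceCT`), and by the measure change of `GrassmannGaussianQuadraticInsertion`

  `∫ dμ_{C^K} e^{−𝒩_K} F = (∫ dμ_{C^K} e^{−𝒩_K}) · ∫ dμ_{C} F`            (`gaussExpect_hubbardCovarianceCT_counterterm_mul`)
  `∫ dμ_{C^K} e^{−(V + 𝒩_K)} = (∫ dμ_{C^K} e^{−𝒩_K}) · ∫ dμ_{C} e^{−V}`    (`effPartitionFn_hubbardCovarianceCT_add_counterQuadratic`,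
                                                                          `effPartitionFn_hubbardInteractionCT`)
  `(∫ dμ_{C^K} e^{−𝒩_K})² = det(1 + C^K S_K)`, `· det(1 − C^0 S_K) = 1`    (`sq_gaussExpect_counterQuadratic(_mul_det)`)

for EVERY frame `K`, every `U` (inside `V`), `μ`, `h`, `β ≠ 0`, at finite `(L, M)`: the Grassmann model "covariance of `e_K` + vertex
`V + 𝒩_K`" IS the bare Grassmann model as a Gaussian functional on the whole field algebra (BGM 2003 (2.9)–(2.10): `P(dψ)` with
`ε = ε₀ − δε` and `e^{−𝒱−𝒩}`; `−𝒩_K` as a quadratic insertion: `neg_counterQuadratic_eq_sum`).  In particular a CONSTANT frame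
`K ≡ c` is the shift `μ ↦ μ + c` of the covariance (`hubbardCovarianceCT_of_eval_eq_const`): a constant density counterterm in the
vertex and a shift of the Grassmann chemical potential are the same thing at finite `M`.

## Sources

J. Feldman, M. Salmhofer, E. Trubowitz, J. Stat. Phys. 84 (1996) 1209, §1–2 [`FeldmanSalmhoferTrubowitz1996`]; G. Benfatto,
A. Giuliani, V. Mastropietro, Ann. Henri Poincaré 4 (2003) 137, §1.2 (2.6)–(2.10) [`BenfattoGiulianiMastropietro2003`]. [folklore]
-/

noncomputable section

namespace Literature.MathematicalPhysics.QuantumLattice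

open Literature.Probability.LatticeModels GrassmannAlgebra Finset Matrix

variable (L M : ℕ)

/-! ### §1 The Nambu blocks: `G_K − G_0 = K(p) G_K τ₃ G_0 = K(p) G_0 τ₃ G_K` -/

section NambuBlocks

variable (β μ h : ℝ) (K : TrigPolyC4v)

/-- The BCS denominator in any frame is positive for `β ≠ 0` (the fermionic frequencies do not vanish). [folklore] -/
theorem nambuDenCT_pos {β : ℝ} (hβ : β ≠ 0) (μ h : ℝ) (K : TrigPolyC4v) (k : FreqMomentum L M) :
    0 < nambuDenCT L M β μ h K k := by
  have hω := matsubaraFreq_ne_zero (M := M) hβ k.1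
  unfold nambuDenCT
  positivity

/-- **The Nambu propagator inverts `−iω + M_K(k⃗)`**: `G_K(k) · [[−iω + e_K, hφ_d],[hφ_d, −iω − e_K]] = 1` (`β ≠ 0`). [folklore] -/
theorem nambuPropagatorCT_mul_inv {β : ℝ} (hβ : β ≠ 0) (k : FreqMomentum L M) :
    nambuPropagatorCT L M β μ h K k *
        !![-Complex.I * matsubaraFreq β M k.1 + nambuXiCT L μ K k.2, (h * dWaveSymbol L k.2 : ℝ);
          (h * dWaveSymbol L k.2 : ℝ), -Complex.I * matsubaraFreq β M k.1 - nambuXiCT L μ K k.2] = 1 := by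
  have hden : ((nambuDenCT L M β μ h K k : ℝ) : ℂ) ≠ 0 :=
    Complex.ofReal_ne_zero.2 (nambuDenCT_pos L M hβ μ h K k).ne'
  have hden' : ((nambuDenCT L M β μ h K k : ℝ) : ℂ) =
      (matsubaraFreq β M k.1 : ℂ) ^ 2 + (nambuXiCT L μ K k.2 : ℂ) ^ 2 + ((h * dWaveSymbol L k.2 : ℝ) : ℂ) ^ 2 := by
    simp only [nambuDenCT]; push_cast; ring
  ext i j
  fin_cases i <;> fin_cases j <;>
    simp [nambuPropagatorCT, Matrix.mul_apply, Fin.sum_univ_two] <;>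
    field_simp <;> rw [hden'] <;> push_cast <;> ring_nf <;> simp only [Complex.I_sq] <;> ring

/-- `[[−iω + e_K, hφ],[hφ, −iω − e_K]] · G_K(k) = 1` (the other side). [folklore] -/
theorem inv_mul_nambuPropagatorCT {β : ℝ} (hβ : β ≠ 0) (k : FreqMomentum L M) :
    !![-Complex.I * matsubaraFreq β M k.1 + nambuXiCT L μ K k.2, (h * dWaveSymbol L k.2 : ℝ);
        (h * dWaveSymbol L k.2 : ℝ), -Complex.I * matsubaraFreq β M k.1 - nambuXiCT L μ K k.2] *
      nambuPropagatorCT L M β μ h K k = 1 :=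
  mul_eq_one_comm.1 (nambuPropagatorCT_mul_inv L M μ h K hβ k)

/-- The inverse propagators of the frame `K` and of the bare frame differ by the counterterm on `τ₃`:
`(−iω + M_0) − (−iω + M_K) = K(p) τ₃`. [folklore] -/
theorem inv_sub_inv_eq_tau3 (k : FreqMomentum L M) :
    !![-Complex.I * matsubaraFreq β M k.1 + nambuXiCT L μ 0 k.2, (h * dWaveSymbol L k.2 : ℝ);
        (h * dWaveSymbol L k.2 : ℝ), -Complex.I * matsubaraFreq β M k.1 - nambuXiCT L μ 0 k.2] -
      !![-Complex.I * matsubaraFreq β M k.1 + nambuXiCT L μ K k.2, (h * dWaveSymbol L k.2 : ℝ);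
        (h * dWaveSymbol L k.2 : ℝ), -Complex.I * matsubaraFreq β M k.1 - nambuXiCT L μ K k.2] =
      (K.eval (latticeMomentum L k.2) : ℂ) • !![(1 : ℂ), 0; 0, -1] := by
  have hK : (nambuXi L μ k.2 : ℂ) - nambuXiCT L μ K k.2 = K.eval (latticeMomentum L k.2) := by
    rw [nambuXi_eq_nambuXiCT_add L μ K k.2]
    push_cast; ring
  ext i j
  fin_cases i <;> fin_cases j
  · simp [Matrix.sub_apply]; linear_combination hK
  · simp [Matrix.sub_apply]
  · simp [Matrix.sub_apply]
  · simp [Matrix.sub_apply]; linear_combination -hK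

/-- **The resolvent identity of the Nambu blocks**, first form: `G_K(k) − G_0(k) = K(p) · G_K τ₃ G_0` (`β ≠ 0`). [folklore] -/
theorem nambuPropagatorCT_sub_eq_mul_tau3_mul {β : ℝ} (hβ : β ≠ 0) (k : FreqMomentum L M) :
    nambuPropagatorCT L M β μ h K k - nambuPropagatorCT L M β μ h 0 k =
      (K.eval (latticeMomentum L k.2) : ℂ) •
        (nambuPropagatorCT L M β μ h K k * !![(1 : ℂ), 0; 0, -1] * nambuPropagatorCT L M β μ h 0 k) := by
  set GK := nambuPropagatorCT L M β μ h K k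
  set G0 := nambuPropagatorCT L M β μ h 0 k
  set AK := !![-Complex.I * matsubaraFreq β M k.1 + nambuXiCT L μ K k.2, (h * dWaveSymbol L k.2 : ℝ);
      (h * dWaveSymbol L k.2 : ℝ), -Complex.I * matsubaraFreq β M k.1 - nambuXiCT L μ K k.2] with hAK
  set A0 := !![-Complex.I * matsubaraFreq β M k.1 + nambuXiCT L μ 0 k.2, (h * dWaveSymbol L k.2 : ℝ);
      (h * dWaveSymbol L k.2 : ℝ), -Complex.I * matsubaraFreq β M k.1 - nambuXiCT L μ 0 k.2] with hA0
  have h1 : GK * AK = 1 := nambuPropagatorCT_mul_inv L M μ h K hβ k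
  have h2 : A0 * G0 = 1 := inv_mul_nambuPropagatorCT L M μ h 0 hβ k
  have h3 : A0 - AK = (K.eval (latticeMomentum L k.2) : ℂ) • !![(1 : ℂ), 0; 0, -1] := inv_sub_inv_eq_tau3 L M β μ h K k
  calc GK - G0 = GK * (A0 * G0) - (GK * AK) * G0 := by rw [h1, h2, Matrix.mul_one, Matrix.one_mul]
    _ = GK * (A0 - AK) * G0 := by simp only [Matrix.mul_sub, Matrix.sub_mul, Matrix.mul_assoc]
    _ = _ := by rw [h3, Matrix.mul_smul, Matrix.smul_mul]

/-- **The resolvent identity of the Nambu blocks**, second form: `G_K(k) − G_0(k) = K(p) · G_0 τ₃ G_K` (`β ≠ 0`). [folklore] -/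
theorem nambuPropagatorCT_sub_eq_mul_tau3_mul' {β : ℝ} (hβ : β ≠ 0) (k : FreqMomentum L M) :
    nambuPropagatorCT L M β μ h K k - nambuPropagatorCT L M β μ h 0 k =
      (K.eval (latticeMomentum L k.2) : ℂ) •
        (nambuPropagatorCT L M β μ h 0 k * !![(1 : ℂ), 0; 0, -1] * nambuPropagatorCT L M β μ h K k) := by
  set GK := nambuPropagatorCT L M β μ h K k
  set G0 := nambuPropagatorCT L M β μ h 0 k
  set AK := !![-Complex.I * matsubaraFreq β M k.1 + nambuXiCT L μ K k.2, (h * dWaveSymbol L k.2 : ℝ);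
      (h * dWaveSymbol L k.2 : ℝ), -Complex.I * matsubaraFreq β M k.1 - nambuXiCT L μ K k.2] with hAK
  set A0 := !![-Complex.I * matsubaraFreq β M k.1 + nambuXiCT L μ 0 k.2, (h * dWaveSymbol L k.2 : ℝ);
      (h * dWaveSymbol L k.2 : ℝ), -Complex.I * matsubaraFreq β M k.1 - nambuXiCT L μ 0 k.2] with hA0
  have h1 : AK * GK = 1 := inv_mul_nambuPropagatorCT L M μ h K hβ k
  have h2 : G0 * A0 = 1 := nambuPropagatorCT_mul_inv L M μ h 0 hβ k
  have h3 : A0 - AK = (K.eval (latticeMomentum L k.2) : ℂ) • !![(1 : ℂ), 0; 0, -1] := inv_sub_inv_eq_tau3 L M β μ h K k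
  calc GK - G0 = (G0 * A0) * GK - G0 * (AK * GK) := by rw [h1, h2, Matrix.mul_one, Matrix.one_mul]
    _ = G0 * (A0 - AK) * GK := by simp only [Matrix.mul_sub, Matrix.sub_mul, Matrix.mul_assoc]
    _ = _ := by rw [h3, Matrix.mul_smul, Matrix.smul_mul]

end NambuBlocks

/-! ### §2 The antisymmetrised Nambu tables `ñ_K(P,Q) = n_K(P,Q) − n_K(Q,P)` by charge sectors -/

section NambuTables

variable {L M}
variable (β μ h : ℝ) (K : TrigPolyC4v)

/-- `ñ_K` on the sector `(Ψ⁻, Ψ⁺)`: `βL² δ_{pq} G_K(p)_{ab}`. [folklore] -/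
theorem nambuAnti_one_zero (p q : FreqMomentum L M) (a b : Fin 2) :
    nambuTwoPointCT L M β μ h K ((p, a), 1) ((q, b), 0) - nambuTwoPointCT L M β μ h K ((q, b), 0) ((p, a), 1) =
      if p = q then ((β * (L : ℝ) ^ 2 : ℝ) : ℂ) * nambuPropagatorCT L M β μ h K p a b else 0 := by
  simp [nambuTwoPointCT]

/-- `ñ_K` on the sector `(Ψ⁺, Ψ⁻)`: `−βL² δ_{pq} G_K(p)_{ba}`. [folklore] -/
theorem nambuAnti_zero_one (p q : FreqMomentum L M) (a b : Fin 2) :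
    nambuTwoPointCT L M β μ h K ((p, a), 0) ((q, b), 1) - nambuTwoPointCT L M β μ h K ((q, b), 1) ((p, a), 0) =
      if p = q then -(((β * (L : ℝ) ^ 2 : ℝ) : ℂ) * nambuPropagatorCT L M β μ h K p b a) else 0 := by
  by_cases hpq : p = q
  · subst hpq; simp [nambuTwoPointCT]
  · simp [nambuTwoPointCT, hpq, Ne.symm hpq]

/-- `ñ_K` vanishes on the sector `(Ψ⁺, Ψ⁺)`. [folklore] -/
theorem nambuAnti_zero_zero (p q : FreqMomentum L M) (a b : Fin 2) :
    nambuTwoPointCT L M β μ h K ((p, a), 0) ((q, b), 0) - nambuTwoPointCT L M β μ h K ((q, b), 0) ((p, a), 0) = 0 := by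
  simp [nambuTwoPointCT]

/-- `ñ_K` vanishes on the sector `(Ψ⁻, Ψ⁻)`. [folklore] -/
theorem nambuAnti_one_one (p q : FreqMomentum L M) (a b : Fin 2) :
    nambuTwoPointCT L M β μ h K ((p, a), 1) ((q, b), 1) - nambuTwoPointCT L M β μ h K ((q, b), 1) ((p, a), 1) = 0 := by
  simp [nambuTwoPointCT]

/-- Entries of `G_K τ₃ G_0`. [folklore] -/
theorem mul_tau3_mul_apply (G G' : Matrix (Fin 2) (Fin 2) ℂ) (a b : Fin 2) :
    (G * !![(1 : ℂ), 0; 0, -1] * G') a b = G a 0 * G' 0 b - G a 1 * G' 1 b := by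
  simp [Matrix.mul_apply, Fin.sum_univ_two]
  ring

variable [NeZero L]

/-- **The resolvent identity for the antisymmetrised Nambu tables**:
`ñ_0(P,Q) − ñ_K(P,Q) = Σ_k (K(p_k)/(βL²)) Σ_a τ₃(a) [ñ_K(P,(k,a,Ψ⁺)) ñ_0((k,a,Ψ⁻),Q) − ñ_K(P,(k,a,Ψ⁻)) ñ_0((k,a,Ψ⁺),Q)]`
(`β ≠ 0`; by charge sectors it is `G_K − G_0 = K G_K τ₃ G_0` resp. `= K G_0 τ₃ G_K`). [folklore] -/
theorem nambuAnti_resolvent {β : ℝ} (hβ : β ≠ 0) (P Q : (FreqMomentum L M × Fin 2) × Fin 2) :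
    (nambuTwoPointCT L M β μ h 0 P Q - nambuTwoPointCT L M β μ h 0 Q P) -
        (nambuTwoPointCT L M β μ h K P Q - nambuTwoPointCT L M β μ h K Q P) =
      ∑ k : FreqMomentum L M, ((K.eval (latticeMomentum L k.2) / (β * (L : ℝ) ^ 2) : ℝ) : ℂ) *
        ∑ a : Fin 2, (!![(1 : ℂ), 0; 0, -1] a a) *
          ((nambuTwoPointCT L M β μ h K P ((k, a), 1) - nambuTwoPointCT L M β μ h K ((k, a), 1) P) *
              (nambuTwoPointCT L M β μ h 0 ((k, a), 0) Q - nambuTwoPointCT L M β μ h 0 Q ((k, a), 0)) -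
            (nambuTwoPointCT L M β μ h K P ((k, a), 0) - nambuTwoPointCT L M β μ h K ((k, a), 0) P) *
              (nambuTwoPointCT L M β μ h 0 ((k, a), 1) Q - nambuTwoPointCT L M β μ h 0 Q ((k, a), 1))) := by
  have hL : (L : ℝ) ≠ 0 := Nat.cast_ne_zero.2 (NeZero.ne L)
  have hB : ((β * (L : ℝ) ^ 2 : ℝ) : ℂ) ≠ 0 := by exact_mod_cast mul_ne_zero hβ (pow_ne_zero 2 hL)
  -- the coupling times `βL²` is the counterterm
  have hc : ∀ k : FreqMomentum L M, ((K.eval (latticeMomentum L k.2) / (β * (L : ℝ) ^ 2) : ℝ) : ℂ) *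
      ((β * (L : ℝ) ^ 2 : ℝ) : ℂ) = (K.eval (latticeMomentum L k.2) : ℂ) := by
    intro k
    rw [Complex.ofReal_div, div_mul_cancel₀ _ hB]
  obtain ⟨⟨p, a⟩, cP⟩ := P
  obtain ⟨⟨q, b⟩, cQ⟩ := Q
  fin_cases cP <;> fin_cases cQ
  · -- `(Ψ⁺, Ψ⁺)`: both sides vanish
    simp [nambuAnti_zero_zero, nambuAnti_zero_one, nambuAnti_one_zero]
  · -- `(Ψ⁺, Ψ⁻)`: `G_K − G_0 = K G_0 τ₃ G_K`
    simp only [Fin.zero_eta, Fin.isValue, Fin.mk_one, nambuAnti_zero_one, nambuAnti_zero_zero, zero_mul, sub_zero]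
    by_cases hpq : p = q
    · subst hpq
      simp only [if_true]
      rw [Finset.sum_eq_single p]
      · simp only [if_true]
        have hI := nambuPropagatorCT_sub_eq_mul_tau3_mul' L M μ h K hβ p
        have hab := congrFun (congrFun hI b) a
        simp only [Matrix.sub_apply, Matrix.smul_apply, smul_eq_mul, mul_tau3_mul_apply] at hab
        rw [Fin.sum_univ_two]
        simp only [Matrix.of_apply, Matrix.cons_val', Matrix.cons_val_zero, Matrix.cons_val_one,
          Matrix.cons_val_fin_one, Matrix.empty_val', Fin.isValue]
        linear_combination (((β * (L : ℝ) ^ 2 : ℝ) : ℂ)) * hab -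
          ((β * (L : ℝ) ^ 2 : ℝ) : ℂ) * (nambuPropagatorCT L M β μ h 0 p b 0 * nambuPropagatorCT L M β μ h K p 0 a -
            nambuPropagatorCT L M β μ h 0 p b 1 * nambuPropagatorCT L M β μ h K p 1 a) * hc p
      · intro k _ hk
        simp [Ne.symm hk]
      · simp
    · simp only [hpq, if_false, sub_self]
      symm
      refine Finset.sum_eq_zero fun k _ => ?_
      by_cases hpk : p = k
      · subst hpk; simp [hpq]
      · simp [hpk]
  · -- `(Ψ⁻, Ψ⁺)`: `G_K − G_0 = K G_K τ₃ G_0`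
    simp only [Fin.zero_eta, Fin.isValue, Fin.mk_one, nambuAnti_one_zero, nambuAnti_one_one, zero_mul, zero_sub]
    by_cases hpq : p = q
    · subst hpq
      simp only [if_true]
      rw [Finset.sum_eq_single p]
      · simp only [if_true]
        have hI := nambuPropagatorCT_sub_eq_mul_tau3_mul L M μ h K hβ p
        have hab := congrFun (congrFun hI a) b
        simp only [Matrix.sub_apply, Matrix.smul_apply, smul_eq_mul, mul_tau3_mul_apply] at hab
        rw [Fin.sum_univ_two]
        simp only [Matrix.of_apply, Matrix.cons_val', Matrix.cons_val_zero, Matrix.cons_val_one,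
          Matrix.cons_val_fin_one, Matrix.empty_val', Fin.isValue]
        linear_combination (-((β * (L : ℝ) ^ 2 : ℝ) : ℂ)) * hab +
          ((β * (L : ℝ) ^ 2 : ℝ) : ℂ) * (nambuPropagatorCT L M β μ h K p a 0 * nambuPropagatorCT L M β μ h 0 p 0 b -
            nambuPropagatorCT L M β μ h K p a 1 * nambuPropagatorCT L M β μ h 0 p 1 b) * hc p
      · intro k _ hk
        simp [Ne.symm hk]
      · simp
    · simp only [hpq, if_false, sub_self]
      symm
      refine Finset.sum_eq_zero fun k _ => ?_
      by_cases hpk : p = k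
      · subst hpk; simp [hpq]
      · simp [hpk]
  · -- `(Ψ⁻, Ψ⁻)`: both sides vanish
    simp [nambuAnti_one_one, nambuAnti_one_zero, nambuAnti_zero_one]

end NambuTables

/-! ### §3 Transport to the field labels: `C^K − C^0 = C^K S_K C^0` -/

section Transport

variable {L M}

/-- The Nambu relabelling fixes spin-`↑` labels. [folklore] -/
@[simp] theorem toNambu_up (k : FreqMomentum L M) (c : Fin 2) : toNambu (((k, 0), c) : HubbardFieldIdx L M) = ((k, 0), c) := by
  simp [toNambu]

/-- The Nambu relabelling of `ψ̂⁺_{k↓}` is `Ψ⁻_{-k,2}`. [folklore] -/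
@[simp] theorem toNambu_down_plus (k : FreqMomentum L M) : toNambu (((k, 1), 0) : HubbardFieldIdx L M) = ((k.neg, 1), 1) := by
  simp [toNambu]

/-- The Nambu relabelling of `ψ̂⁻_{k↓}` is `Ψ⁺_{-k,2}`. [folklore] -/
@[simp] theorem toNambu_down_minus (k : FreqMomentum L M) : toNambu (((k, 1), 1) : HubbardFieldIdx L M) = ((k.neg, 1), 0) := by
  simp [toNambu]

/-- Momentum reflection `k ↦ -k` (with the frequency label reflected) is an involution of `FreqMomentum`. [folklore] -/
theorem FreqMomentum.neg_involutive : Function.Involutive (FreqMomentum.neg : FreqMomentum L M → FreqMomentum L M) :=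
  FreqMomentum.neg_neg

variable [NeZero L]

/-- **Contracting the counterterm matrix**: for `S = N − Nᵀ` with `N(Z,W) = −c(Z₁) δ_{Z = (Z₁,ψ⁺)} δ_{W = (Z₁,ψ⁻)}`,
`(P S Q)(X,Y) = Σ_{Z₁} c(Z₁) [P(X,(Z₁,ψ⁻)) Q((Z₁,ψ⁺),Y) − P(X,(Z₁,ψ⁺)) Q((Z₁,ψ⁻),Y)]`. [folklore] -/
theorem mul_counterMatrix_mul_apply (P Q : Matrix (HubbardFieldIdx L M) (HubbardFieldIdx L M) ℂ)
    (c : FreqMomentum L M × Fin 2 → ℂ) (X Y : HubbardFieldIdx L M) :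
    (P * Matrix.of (fun Z W : HubbardFieldIdx L M =>
        (if Z.2 = 0 ∧ W = (Z.1, 1) then -c Z.1 else 0) - (if W.2 = 0 ∧ Z = (W.1, 1) then -c W.1 else 0)) * Q) X Y =
      ∑ Z₁ : FreqMomentum L M × Fin 2, c Z₁ * (P X (Z₁, 1) * Q (Z₁, 0) Y - P X (Z₁, 0) * Q (Z₁, 1) Y) := by
  -- the two halves of `S`, contracted against `P` on the left
  have t1 : ∀ W : HubbardFieldIdx L M,
      ∑ Z : HubbardFieldIdx L M, P X Z * (if Z.2 = 0 ∧ W = (Z.1, 1) then -c Z.1 else 0) =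
        if W.2 = 1 then P X (W.1, 0) * (-c W.1) else 0 := by
    rintro ⟨W₁, cW⟩
    fin_cases cW
    · simp only [Fin.zero_eta, Fin.isValue, zero_ne_one, if_false]
      refine Finset.sum_eq_zero fun Z _ => ?_
      rw [if_neg, mul_zero]
      rintro ⟨-, h⟩
      exact absurd (congrArg Prod.snd h) (by simp)
    · simp only [Fin.mk_one, Fin.isValue, if_true]
      rw [Fintype.sum_prod_type]
      simp only [Fin.sum_univ_two, Fin.isValue, one_ne_zero, false_and, if_false, mul_zero, add_zero, true_and,
        Prod.mk.injEq, and_true, mul_ite, Finset.sum_ite_eq, Finset.mem_univ, if_true]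
  have t2 : ∀ W : HubbardFieldIdx L M,
      ∑ Z : HubbardFieldIdx L M, P X Z * (if W.2 = 0 ∧ Z = (W.1, 1) then -c W.1 else 0) =
        if W.2 = 0 then P X (W.1, 1) * (-c W.1) else 0 := by
    rintro ⟨W₁, cW⟩
    fin_cases cW
    · simp only [Fin.zero_eta, Fin.isValue, true_and, if_true, mul_ite, mul_zero, Finset.sum_ite_eq', Finset.mem_univ]
    · simp
  simp only [Matrix.mul_apply, Matrix.of_apply, mul_sub, Finset.sum_sub_distrib, t1, t2]
  rw [Fintype.sum_prod_type]
  simp only [Fin.sum_univ_two, Fin.isValue, zero_ne_one, if_false, one_ne_zero, if_true, zero_sub, sub_zero]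
  rw [← Finset.sum_sub_distrib]
  refine Finset.sum_congr rfl fun Z₁ _ => ?_
  ring

/-- **The spin sum in Nambu labels**: contracting the counterterm (which carries both spins at `(k, σ)`) against two tables
transported along `toNambu` is the `τ₃`-weighted Nambu sum, after reflecting `k ↦ -k` in the spin-`↓` half (`κ` even). [folklore] -/
theorem counter_sum_toNambu (κ : FreqMomentum L M → ℂ) (hκ : ∀ k, κ k.neg = κ k)
    (A B : (FreqMomentum L M × Fin 2) × Fin 2 → ℂ) :
    ∑ Z₁ : FreqMomentum L M × Fin 2, κ Z₁.1 *
        (A (toNambu ((Z₁, 1) : HubbardFieldIdx L M)) * B (toNambu ((Z₁, 0) : HubbardFieldIdx L M)) -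
          A (toNambu ((Z₁, 0) : HubbardFieldIdx L M)) * B (toNambu ((Z₁, 1) : HubbardFieldIdx L M))) =
      ∑ k : FreqMomentum L M, κ k * ∑ a : Fin 2, (!![(1 : ℂ), 0; 0, -1] a a) *
        (A ((k, a), 1) * B ((k, a), 0) - A ((k, a), 0) * B ((k, a), 1)) := by
  rw [Fintype.sum_prod_type]
  simp only [Fin.sum_univ_two, Fin.isValue, toNambu_up, toNambu_down_plus, toNambu_down_minus]
  rw [Finset.sum_add_distrib]
  have hrefl : ∑ k : FreqMomentum L M, κ k * (A ((k.neg, 1), 0) * B ((k.neg, 1), 1) - A ((k.neg, 1), 1) * B ((k.neg, 1), 0)) =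
      ∑ k : FreqMomentum L M, κ k * (A ((k, 1), 0) * B ((k, 1), 1) - A ((k, 1), 1) * B ((k, 1), 0)) := by
    have h := Equiv.sum_comp (Function.Involutive.toPerm _ FreqMomentum.neg_involutive)
      (fun k => κ k * (A ((k, 1), 0) * B ((k, 1), 1) - A ((k, 1), 1) * B ((k, 1), 0)))
    simp only [Function.Involutive.coe_toPerm] at h
    rw [← h]
    refine Finset.sum_congr rfl fun k _ => ?_
    rw [hκ k]
  rw [hrefl, ← Finset.sum_add_distrib]
  refine Finset.sum_congr rfl fun k _ => ?_
  simp only [Matrix.of_apply, Matrix.cons_val', Matrix.cons_val_zero, Matrix.cons_val_one, Matrix.cons_val_fin_one,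
    Matrix.empty_val']
  ring

variable (L M) (β μ h : ℝ) (K : TrigPolyC4v)

omit [NeZero L] in
/-- An entry of `C^K` through the antisymmetrised Nambu table: `C^K(X,Z) = −ñ_K(X̃, Z̃)`. [folklore] -/
theorem hubbardCovarianceCT_apply (X Z : HubbardFieldIdx L M) :
    hubbardCovarianceCT L M β μ h K X Z =
      -(nambuTwoPointCT L M β μ h K (toNambu X) (toNambu Z) - nambuTwoPointCT L M β μ h K (toNambu Z) (toNambu X)) := rfl

/-- **The counterterm frame as a resolvent**: `C^K − C^0 = C^K S_K C^0` with `S_K = N_K − N_Kᵀ`,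
`N_K((k,σ,ψ⁺),(k,σ,ψ⁻)) = −K(p_k)/(βL²)` (so that `−𝒩_K = Σ N_K(X,Y)ψ(X)ψ(Y)`, `neg_counterQuadratic_eq_sum`), for every
frame `K`, `β ≠ 0` (Feldman–Salmhofer–Trubowitz 1996 §1: `E = e + K`; BGM 2003 (2.6)–(2.10)).
[cite: FeldmanSalmhoferTrubowitz1996, §1–2] -/
theorem hubbardCovarianceCT_sub_eq_mul_counterMatrix_mul {β : ℝ} (hβ : β ≠ 0) :
    hubbardCovarianceCT L M β μ h K - hubbardCovarianceCT L M β μ h 0 =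
      hubbardCovarianceCT L M β μ h K *
        Matrix.of (fun Z W : HubbardFieldIdx L M =>
          (if Z.2 = 0 ∧ W = (Z.1, 1) then -(((K.eval (latticeMomentum L Z.1.1.2) / (β * (L : ℝ) ^ 2) : ℝ) : ℂ)) else 0) -
          (if W.2 = 0 ∧ Z = (W.1, 1) then -(((K.eval (latticeMomentum L W.1.1.2) / (β * (L : ℝ) ^ 2) : ℝ) : ℂ)) else 0)) *
        hubbardCovarianceCT L M β μ h 0 := by
  set κ : FreqMomentum L M → ℂ := fun k => ((K.eval (latticeMomentum L k.2) / (β * (L : ℝ) ^ 2) : ℝ) : ℂ) with hκdef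
  have hκ : ∀ k, κ k.neg = κ k := by
    intro k
    simp only [hκdef, show k.neg.2 = -k.2 from rfl, TrigPolyC4v.eval_latticeMomentum_neg]
  ext X Y
  rw [Matrix.sub_apply]
  have hA := mul_counterMatrix_mul_apply (hubbardCovarianceCT L M β μ h K) (hubbardCovarianceCT L M β μ h 0)
    (fun Z₁ => κ Z₁.1) X Y
  refine Eq.trans ?_ hA.symm
  have hN := nambuAnti_resolvent μ h K hβ (toNambu X) (toNambu Y)
  have hL2 := counter_sum_toNambu κ hκ
    (fun P => nambuTwoPointCT L M β μ h K (toNambu X) P - nambuTwoPointCT L M β μ h K P (toNambu X))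
    (fun P => nambuTwoPointCT L M β μ h 0 P (toNambu Y) - nambuTwoPointCT L M β μ h 0 (toNambu Y) P)
  simp only [hubbardCovarianceCT_apply, neg_mul_neg]
  rw [hL2, show ∀ a b : ℂ, -a - -b = b - a from fun a b => by ring, hN]

end Transport

/-! ### §4 Consequences: the resolvent, the measure change, constant frames -/

section Consequences

variable [NeZero L] (β μ h : ℝ) (K : TrigPolyC4v)

/-- **The counterterm as a quadratic insertion**: `−𝒩_K = Σ_{X,Y} N_K(X,Y) ψ(X)ψ(Y)` with
`N_K((k,σ,ψ⁺),(k,σ,ψ⁻)) = −K(p_k)/(βL²)` and `0` otherwise. [folklore] -/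
theorem neg_counterQuadratic_eq_sum :
    -counterQuadratic L M β K =
      ∑ X : HubbardFieldIdx L M, ∑ Y : HubbardFieldIdx L M,
        (Matrix.of fun Z W : HubbardFieldIdx L M =>
          if Z.2 = 0 ∧ W = (Z.1, 1) then -(((K.eval (latticeMomentum L Z.1.1.2) / (β * (L : ℝ) ^ 2) : ℝ) : ℂ)) else 0) X Y •
          (gen ℂ X * gen ℂ Y) := by
  have inner : ∀ X : HubbardFieldIdx L M,
      ∑ Y : HubbardFieldIdx L M, (Matrix.of fun Z W : HubbardFieldIdx L M =>
          if Z.2 = 0 ∧ W = (Z.1, 1) then -(((K.eval (latticeMomentum L Z.1.1.2) / (β * (L : ℝ) ^ 2) : ℝ) : ℂ)) else 0) X Y •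
          (gen ℂ X * gen ℂ Y) =
        if X.2 = 0 then (-(((K.eval (latticeMomentum L X.1.1.2) / (β * (L : ℝ) ^ 2) : ℝ) : ℂ))) • (gen ℂ X * gen ℂ (X.1, 1))
        else 0 := by
    rintro ⟨X₁, c⟩
    fin_cases c
    · simp only [Matrix.of_apply, Fin.zero_eta, Fin.isValue, true_and, ite_smul, zero_smul, Finset.sum_ite_eq',
        Finset.mem_univ, if_true]
    · simp
  simp only [inner]
  simp only [Fintype.sum_prod_type, Fin.sum_univ_two, Fin.isValue, if_true, one_ne_zero, if_false, add_zero, counterQuadratic,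
    ← Finset.sum_neg_distrib]
  refine Finset.sum_congr rfl fun x _ => Finset.sum_congr rfl fun y _ => ?_
  rw [neg_add, ← neg_smul, ← neg_smul]
  rfl

/-- **The two resolvents are inverse to each other**: `(1 + C^K S_K)(1 − C^0 S_K) = 1` (`β ≠ 0`). [folklore] -/
theorem counterResolvent_mul {β : ℝ} (hβ : β ≠ 0) :
    (1 + hubbardCovarianceCT L M β μ h K *
        Matrix.of (fun Z W : HubbardFieldIdx L M =>
          (if Z.2 = 0 ∧ W = (Z.1, 1) then -(((K.eval (latticeMomentum L Z.1.1.2) / (β * (L : ℝ) ^ 2) : ℝ) : ℂ)) else 0) -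
          (if W.2 = 0 ∧ Z = (W.1, 1) then -(((K.eval (latticeMomentum L W.1.1.2) / (β * (L : ℝ) ^ 2) : ℝ) : ℂ)) else 0))) *
      (1 - hubbardCovarianceCT L M β μ h 0 *
        Matrix.of (fun Z W : HubbardFieldIdx L M =>
          (if Z.2 = 0 ∧ W = (Z.1, 1) then -(((K.eval (latticeMomentum L Z.1.1.2) / (β * (L : ℝ) ^ 2) : ℝ) : ℂ)) else 0) -
          (if W.2 = 0 ∧ Z = (W.1, 1) then -(((K.eval (latticeMomentum L W.1.1.2) / (β * (L : ℝ) ^ 2) : ℝ) : ℂ)) else 0))) = 1 := by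
  set S := Matrix.of (fun Z W : HubbardFieldIdx L M =>
    (if Z.2 = 0 ∧ W = (Z.1, 1) then -(((K.eval (latticeMomentum L Z.1.1.2) / (β * (L : ℝ) ^ 2) : ℝ) : ℂ)) else 0) -
    (if W.2 = 0 ∧ Z = (W.1, 1) then -(((K.eval (latticeMomentum L W.1.1.2) / (β * (L : ℝ) ^ 2) : ℝ) : ℂ)) else 0))
  set CK := hubbardCovarianceCT L M β μ h K
  set C0 := hubbardCovarianceCT L M β μ h 0
  have hres : CK * S * C0 = CK - C0 := (hubbardCovarianceCT_sub_eq_mul_counterMatrix_mul L M μ h K hβ).symm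
  calc (1 + CK * S) * (1 - C0 * S) = 1 + CK * S - C0 * S - (CK * S * C0) * S := by
        simp only [Matrix.add_mul, Matrix.mul_sub, Matrix.one_mul, Matrix.mul_one, Matrix.mul_assoc]
        abel
    _ = 1 := by rw [hres, Matrix.sub_mul]; abel

/-- `(1 − C^0 S_K)(1 + C^K S_K) = 1`. [folklore] -/
theorem counterResolvent_mul' {β : ℝ} (hβ : β ≠ 0) :
    (1 - hubbardCovarianceCT L M β μ h 0 *
        Matrix.of (fun Z W : HubbardFieldIdx L M =>
          (if Z.2 = 0 ∧ W = (Z.1, 1) then -(((K.eval (latticeMomentum L Z.1.1.2) / (β * (L : ℝ) ^ 2) : ℝ) : ℂ)) else 0) -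
          (if W.2 = 0 ∧ Z = (W.1, 1) then -(((K.eval (latticeMomentum L W.1.1.2) / (β * (L : ℝ) ^ 2) : ℝ) : ℂ)) else 0))) *
      (1 + hubbardCovarianceCT L M β μ h K *
        Matrix.of (fun Z W : HubbardFieldIdx L M =>
          (if Z.2 = 0 ∧ W = (Z.1, 1) then -(((K.eval (latticeMomentum L Z.1.1.2) / (β * (L : ℝ) ^ 2) : ℝ) : ℂ)) else 0) -
          (if W.2 = 0 ∧ Z = (W.1, 1) then -(((K.eval (latticeMomentum L W.1.1.2) / (β * (L : ℝ) ^ 2) : ℝ) : ℂ)) else 0))) = 1 :=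
  mul_eq_one_comm.1 (counterResolvent_mul L M μ h K hβ)

/-- **The renormalised covariance of the frame is the bare covariance**: `(1 − C^0 S_K) C^K = C^0 = C`. [folklore] -/
theorem counterResolvent_mul_hubbardCovarianceCT {β : ℝ} (hβ : β ≠ 0) :
    (1 - hubbardCovarianceCT L M β μ h 0 *
        Matrix.of (fun Z W : HubbardFieldIdx L M =>
          (if Z.2 = 0 ∧ W = (Z.1, 1) then -(((K.eval (latticeMomentum L Z.1.1.2) / (β * (L : ℝ) ^ 2) : ℝ) : ℂ)) else 0) -
          (if W.2 = 0 ∧ Z = (W.1, 1) then -(((K.eval (latticeMomentum L W.1.1.2) / (β * (L : ℝ) ^ 2) : ℝ) : ℂ)) else 0))) *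
      hubbardCovarianceCT L M β μ h K = hubbardCovariance L M β μ h := by
  set S := Matrix.of (fun Z W : HubbardFieldIdx L M =>
    (if Z.2 = 0 ∧ W = (Z.1, 1) then -(((K.eval (latticeMomentum L Z.1.1.2) / (β * (L : ℝ) ^ 2) : ℝ) : ℂ)) else 0) -
    (if W.2 = 0 ∧ Z = (W.1, 1) then -(((K.eval (latticeMomentum L W.1.1.2) / (β * (L : ℝ) ^ 2) : ℝ) : ℂ)) else 0))
  set CK := hubbardCovarianceCT L M β μ h K
  set C0 := hubbardCovarianceCT L M β μ h 0 with hC0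
  have hres : CK * S * C0 = CK - C0 := (hubbardCovarianceCT_sub_eq_mul_counterMatrix_mul L M μ h K hβ).symm
  have hinv : (1 - C0 * S) * (1 + CK * S) = 1 := counterResolvent_mul' L M μ h K hβ
  have hCK : CK = (1 + CK * S) * C0 := by
    rw [Matrix.add_mul, Matrix.one_mul, hres]; abel
  rw [← hubbardCovarianceCT_zero_frame, ← hC0]
  conv_lhs => rw [hCK, ← Matrix.mul_assoc, hinv, Matrix.one_mul]

/-- **The frame is a change of Gaussian measure** (FST 1996 §1, BGM 2003 (2.9)–(2.10), exactly at finite `L, M, β ≠ 0`): for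
every element `F` of the field algebra, `∫ dμ_{C^K} e^{−𝒩_K} F = (∫ dμ_{C^K} e^{−𝒩_K}) · ∫ dμ_{C} F` — the covariance of the
renormalised band with the counterterm vertex inserted IS the bare covariance. [cite: FeldmanSalmhoferTrubowitz1996, §1–2] -/
theorem gaussExpect_hubbardCovarianceCT_counterterm_mul {β : ℝ} (hβ : β ≠ 0) (F : HubbardGrassmann L M) :
    gaussExpect ℂ (hubbardCovarianceCT L M β μ h K) (grassmannExp (-counterQuadratic L M β K) * F) =
      gaussExpect ℂ (hubbardCovarianceCT L M β μ h K) (grassmannExp (-counterQuadratic L M β K)) *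
        gaussExpect ℂ (hubbardCovariance L M β μ h) F := by
  have hmc := gaussExpect_grassmannExp_mul_of_transpose_eq_neg
    (Matrix.of fun Z W : HubbardFieldIdx L M =>
      if Z.2 = 0 ∧ W = (Z.1, 1) then -(((K.eval (latticeMomentum L Z.1.1.2) / (β * (L : ℝ) ^ 2) : ℝ) : ℂ)) else 0)
    (neg_counterQuadratic_eq_sum L M β K) (hubbardCovarianceCT_transpose L M β μ h K)
    (S := Matrix.of (fun Z W : HubbardFieldIdx L M =>
      (if Z.2 = 0 ∧ W = (Z.1, 1) then -(((K.eval (latticeMomentum L Z.1.1.2) / (β * (L : ℝ) ^ 2) : ℝ) : ℂ)) else 0) -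
      (if W.2 = 0 ∧ Z = (W.1, 1) then -(((K.eval (latticeMomentum L W.1.1.2) / (β * (L : ℝ) ^ 2) : ℝ) : ℂ)) else 0)))
    rfl (counterResolvent_mul' L M μ h K hβ) F
  rwa [counterResolvent_mul_hubbardCovarianceCT L M μ h K hβ] at hmc

/-- **The partition function in the frame `K` factorises**: `∫ dμ_{C^K} e^{−(V + 𝒩_K)} = (∫ dμ_{C^K} e^{−𝒩_K}) · ∫ dμ_{C} e^{−V}` for
every interaction `V` without constant part (e.g. `hubbardInteraction`: `hubbardInteractionCT = V + 𝒩_K`). [cite: FeldmanSalmhoferTrubowitz1996, §1–2] -/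
theorem effPartitionFn_hubbardCovarianceCT_add_counterQuadratic {β : ℝ} (hβ : β ≠ 0) {V : HubbardGrassmann L M}
    (hV : constPart ℂ V = 0) :
    effPartitionFn ℂ (hubbardCovarianceCT L M β μ h K) (V + counterQuadratic L M β K) =
      gaussExpect ℂ (hubbardCovarianceCT L M β μ h K) (grassmannExp (-counterQuadratic L M β K)) *
        effPartitionFn ℂ (hubbardCovariance L M β μ h) V := by
  have hmc := effPartitionFn_sub_of_transpose_eq_neg
    (Matrix.of fun Z W : HubbardFieldIdx L M =>
      if Z.2 = 0 ∧ W = (Z.1, 1) then -(((K.eval (latticeMomentum L Z.1.1.2) / (β * (L : ℝ) ^ 2) : ℝ) : ℂ)) else 0)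
    (neg_counterQuadratic_eq_sum L M β K) (hubbardCovarianceCT_transpose L M β μ h K)
    (S := Matrix.of (fun Z W : HubbardFieldIdx L M =>
      (if Z.2 = 0 ∧ W = (Z.1, 1) then -(((K.eval (latticeMomentum L Z.1.1.2) / (β * (L : ℝ) ^ 2) : ℝ) : ℂ)) else 0) -
      (if W.2 = 0 ∧ Z = (W.1, 1) then -(((K.eval (latticeMomentum L W.1.1.2) / (β * (L : ℝ) ^ 2) : ℝ) : ℂ)) else 0)))
    rfl (counterResolvent_mul' L M μ h K hβ) hV
  rwa [sub_neg_eq_add, counterResolvent_mul_hubbardCovarianceCT L M μ h K hβ] at hmc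

/-- **The full partition function of the seeded Hubbard torus does not depend on the frame**, up to the Gaussian normalisation:
`∫ dμ_{C^K} e^{−V_K} = (∫ dμ_{C^K} e^{−𝒩_K}) · ∫ dμ_{C} e^{−V}`, `V_K = hubbardInteractionCT`, `V = hubbardInteraction`. [cite: FeldmanSalmhoferTrubowitz1996, §1–2] -/
theorem effPartitionFn_hubbardInteractionCT {β : ℝ} (hβ : β ≠ 0) (U : ℝ) :
    effPartitionFn ℂ (hubbardCovarianceCT L M β μ h K) (hubbardInteractionCT L M β U K) =
      gaussExpect ℂ (hubbardCovarianceCT L M β μ h K) (grassmannExp (-counterQuadratic L M β K)) *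
        effPartitionFn ℂ (hubbardCovariance L M β μ h) (hubbardInteraction L M β U) :=
  effPartitionFn_hubbardCovarianceCT_add_counterQuadratic L M μ h K hβ (constPart_hubbardInteraction L M β U)

/-- **The Gaussian normalisation of the frame is a determinant**: `(∫ dμ_{C^K} e^{−𝒩_K})² = det(1 + C^K S_K)`
(`GrassmannGaussianQuadraticNormalisation`); with `counterResolvent_mul`, `det(1 + C^K S_K) · det(1 − C^0 S_K) = 1`. [folklore] -/
theorem sq_gaussExpect_counterQuadratic :
    gaussExpect ℂ (hubbardCovarianceCT L M β μ h K) (grassmannExp (-counterQuadratic L M β K)) ^ 2 =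
      (1 + hubbardCovarianceCT L M β μ h K *
        Matrix.of (fun Z W : HubbardFieldIdx L M =>
          (if Z.2 = 0 ∧ W = (Z.1, 1) then -(((K.eval (latticeMomentum L Z.1.1.2) / (β * (L : ℝ) ^ 2) : ℝ) : ℂ)) else 0) -
          (if W.2 = 0 ∧ Z = (W.1, 1) then -(((K.eval (latticeMomentum L W.1.1.2) / (β * (L : ℝ) ^ 2) : ℝ) : ℂ)) else 0))).det :=
  sq_gaussExpect_grassmannExp_eq_det_of_transpose_eq_neg (hubbardCovarianceCT L M β μ h K)
    (Matrix.of fun Z W : HubbardFieldIdx L M =>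
      if Z.2 = 0 ∧ W = (Z.1, 1) then -(((K.eval (latticeMomentum L Z.1.1.2) / (β * (L : ℝ) ^ 2) : ℝ) : ℂ)) else 0)
    (neg_counterQuadratic_eq_sum L M β K) rfl (hubbardCovarianceCT_transpose L M β μ h K)

/-- In particular the normalisation never vanishes: `(∫ dμ_{C^K} e^{−𝒩_K})² · det(1 − C^0 S_K) = 1` (`β ≠ 0`). [folklore] -/
theorem sq_gaussExpect_counterQuadratic_mul_det {β : ℝ} (hβ : β ≠ 0) :
    gaussExpect ℂ (hubbardCovarianceCT L M β μ h K) (grassmannExp (-counterQuadratic L M β K)) ^ 2 *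
      (1 - hubbardCovarianceCT L M β μ h 0 *
        Matrix.of (fun Z W : HubbardFieldIdx L M =>
          (if Z.2 = 0 ∧ W = (Z.1, 1) then -(((K.eval (latticeMomentum L Z.1.1.2) / (β * (L : ℝ) ^ 2) : ℝ) : ℂ)) else 0) -
          (if W.2 = 0 ∧ Z = (W.1, 1) then -(((K.eval (latticeMomentum L W.1.1.2) / (β * (L : ℝ) ^ 2) : ℝ) : ℂ)) else 0))).det = 1 := by
  rw [sq_gaussExpect_counterQuadratic, ← Matrix.det_mul, counterResolvent_mul L M μ h K hβ, Matrix.det_one]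

omit [NeZero L] in
/-- **A constant frame is a shift of the chemical potential**: if `K(p) = c` for all `p` then `C^K_μ = C_{μ + c}` — a constant
density counterterm in the vertex and a shift of the Grassmann `μ` are the same thing (with `effPartitionFn_hubbardInteractionCT`:
`∫ dμ_{C_{μ+c}} e^{−V − c(βL²)⁻¹Σψ̂⁺ψ̂⁻} ∝ ∫ dμ_{C_μ} e^{−V}` at finite `M`). [folklore] -/
theorem hubbardCovarianceCT_of_eval_eq_const {K : TrigPolyC4v} {c : ℝ} (hK : ∀ p, K.eval p = c) :
    hubbardCovarianceCT L M β μ h K = hubbardCovariance L M β (μ + c) h := by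
  ext X Y
  simp only [hubbardCovarianceCT, hubbardCovariance, Matrix.of_apply, hubbardTwoPointCT, hubbardTwoPoint,
    nambuTwoPointCT_eq_nambuTwoPoint, hK]

end Consequences

end Literature.MathematicalPhysics.QuantumLattice
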